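import Summits.BirchSwinnertonDyer.BirchSwinnertonDyer.Theorems.BiquadraticEisensteinDescentHeegnerTwistCouplingInSupplyHeavyFirstMoment
import Summits.BirchSwinnertonDyer.BirchSwinnertonDyer.Theorems.BiquadraticEisensteinDescentHeegnerTwistCouplingInSupplyNonNullFailsAtTwo
import Summits.BirchSwinnertonDyer.BirchSwinnertonDyer.Theorems.GoldfeldAllTwistsX049PrimeTwistsNull
import Literature.NumberTheory.QuadraticFields.DedekindZetaReducedForms
import Literature.NumberTheory.QuadraticFields.FundamentalDiscriminant
import Literature.NumberTheory.EllipticCurves.HeegnerPointsImaginaryQuadraticProofs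
import HarnessLib

set_option linter.dupNamespace false -- `Summit.BirchSwinnertonDyer.BirchSwinnertonDyer.Theorems.…` (summit = sub, D-0017)
set_option autoImplicit false

/-!
# Crux `HeegnerTwistCouplingInSupply` (stmt-BirchSwinnertonDyer-21381), card `heavy-discriminant-sparsity` —
# §B HEAVY DISCRIMINANTS ARE SPARSE: the card's research lemma `HeavySparse`, PROVED (absolute window form)

Route `BiquadraticEisensteinDescent` (cell `pub/bsd-wall`; width seat `bsd-wall-cm-bed-w4` g29; THEOREMS ONLY,
`--supports 21381`). Second file of the unit «HEAVY-DISCRIMINANT SPARSITY + DENSITY DOOR» (crux idea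
`Cruxes/HeegnerTwistCouplingInSupply/Ideas/heavy-discriminant-sparsity.md`, ideation seat 1 g37). The card calls the
discriminant `d = d_K` of an imaginary quadratic field HEAVY for the prime `p` when `2^{ω(|d|)−1}·p ≤ h_K`; by genus theory
(`2^{ω(|d_K|)−1} ∣ h_K`, tree theorem `two_pow_card_primeFactors_sub_one_dvd_classNumber`) `p ∣ h_K` with `p` odd forces
heaviness, so a LIGHT field has `p ∤ h_K` for free. The card's W-free, L-free research lemma `HeavySparse` asserts that
heavy discriminants are a vanishing fraction of every window `|d| ≤ A·p²` as `p → ∞`. This file PROVES it, in the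
absolute form the density door needs (count `≤ η·A·p²`), from three tree inputs and nothing else:

 (i) genus: a heavy `d` with `ω(|d|) ≥ k + 1` has `h_K ≥ 2^{k}·p` (`two_pow_mul_le_classNumber_of_heavy`);
 (ii) the Gauss first moment `Σ_{−X ≤ D ≤ −1} h(D) ≤ X·⌊√X⌋` of file §A (`…HeavyFirstMoment.lean`, p743936), giving
   `#{d ∈ [−X,−1] : h ≥ 2^{k}p} ≤ A²p²/2^{k}` at `X = A·p²` (`card_filter_le_classNumber_window_le`);
 (iii) square-free integers with `≤ k` prime factors are a null set (`GoldfeldGoodTwists.twistDensity_zero_card_primeFactors_le`,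
   Dirichlet + Legendre sieve), transported to FUNDAMENTAL discriminants (`d_K` is square-free or `4·`square-free,
   `Quadratic.isFundamentalDiscriminant_discr`): `#{d_K ∈ [−X,−1] : ω(|d_K|) ≤ k} ≤ ε·X` for `X ≥ X₀(k, ε)`
   (`card_filter_discr_card_primeFactors_le_eventually_le`).

★★ `heavySparse_window` — for every `A ≥ 1` and `η > 0` there is `p₀` such that for all `p ≥ p₀`
`#{d ∈ [−A·p², −1] : ∃ K imaginary quadratic, d_K = d, 2^{ω(|d|)−1}·p ≤ h_K} ≤ η·A·p²`
(choose `k` with `2^{k} ≥ 2A/η`, then `p₀` from (iii) with `ε = η/2`). No primality of `p` is needed.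

HONEST FRAMING: `p₀(A, η)` is ineffective here (input (iii) is a `Tendsto`); the statement is the h-side of the card only —
W-free and L-free; the L-side (`PropNVAtScale`: positive-density non-vanishing of Heegner twists at scale `A·p²`) is OPEN
and is NOT asserted; C⁺, the registered stubs of 21381, crux 21381 and BSD are NOT proved by any of this.
[cite: Cox2013, §3.B Thm. 3.15 (genus theory), §2.A Thm. 2.13] [cite: MontgomeryVaughan2007, §7.4 (integers with k prime factors)]
-/

noncomputable section

open scoped Classical
open Finset Filter Topology
open Literature.NumberTheory.QuadraticFields Literature.NumberTheory.QuadraticFields.Quadratic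
open Literature.NumberTheory.EllipticCurves
open Summit.BirchSwinnertonDyer.BirchSwinnertonDyer.Theorems.BiquadraticEisensteinDescentHeegnerTwistCouplingInSupplyNonNullFailsAtTwo
open Summit.BirchSwinnertonDyer.BirchSwinnertonDyer.Theorems.InertBadSignedBranchesInertBadAtThreeNonNullOddHeegner

namespace Summit.BirchSwinnertonDyer.BirchSwinnertonDyer.Theorems.HeavyDiscriminant

/-! ## §B.1 Pointwise: genus theory on heavy and light fields -/

/-- **`p ∣ h_K` forces heaviness**: for `K` imaginary quadratic and `p` an odd prime, `p ∣ h_K ⟹ 2^{ω(|d_K|)−1}·p ≤ h_K`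
(genus theory `2^{ω−1} ∣ h_K` and `gcd(2^{ω−1}, p) = 1`). [cite: Cox2013, §3.B Thm. 3.15] -/
theorem two_pow_mul_le_classNumber_of_dvd {K : Type*} [Field K] [NumberField K] (hK : IsImaginaryQuadratic K)
    {p : ℕ} (hp : p.Prime) (hp2 : p ≠ 2) (hdvd : p ∣ NumberField.classNumber K) :
    2 ^ ((NumberField.discr K).natAbs.primeFactors.card - 1) * p ≤ NumberField.classNumber K := by
  have hgen := two_pow_card_primeFactors_sub_one_dvd_classNumber hK
  have hcop : Nat.Coprime (2 ^ ((NumberField.discr K).natAbs.primeFactors.card - 1)) p :=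
    Nat.Coprime.pow_left _ ((Nat.coprime_primes Nat.prime_two hp).2 (Ne.symm hp2))
  exact Nat.le_of_dvd Fintype.card_pos (Nat.Coprime.mul_dvd_of_dvd_of_dvd hcop hgen hdvd)

/-- **A light field has `p ∤ h_K`**: `h_K < 2^{ω(|d_K|)−1}·p`, `p` an odd prime ⟹ `p ∤ h_K`. [cite: Cox2013, §3.B Thm. 3.15] -/
theorem not_dvd_classNumber_of_light {K : Type*} [Field K] [NumberField K] (hK : IsImaginaryQuadratic K)
    {p : ℕ} (hp : p.Prime) (hp2 : p ≠ 2)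
    (hlt : NumberField.classNumber K < 2 ^ ((NumberField.discr K).natAbs.primeFactors.card - 1) * p) :
    ¬ p ∣ NumberField.classNumber K :=
  fun h ↦ absurd (two_pow_mul_le_classNumber_of_dvd hK hp hp2 h) (not_le.mpr hlt)

/-- **Heavy with many prime factors ⟹ large class number**: if `2^{ω(|d_K|)−1}·p ≤ h_K` and `k + 1 ≤ ω(|d_K|)` then
`2^{k}·p ≤ h_K = h(d_K)` (the reduced-forms class number of `d_K`). [cite: Cox2013, §2.A Thm. 2.13] -/
theorem two_pow_mul_le_classNumber_of_heavy {K : Type*} [Field K] [NumberField K] (hK : IsImaginaryQuadratic K)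
    {p k : ℕ} (hheavy : 2 ^ ((NumberField.discr K).natAbs.primeFactors.card - 1) * p ≤ NumberField.classNumber K)
    (hk : k + 1 ≤ (NumberField.discr K).natAbs.primeFactors.card) :
    2 ^ k * p ≤ BinaryQuadraticForm.classNumber (NumberField.discr K) := by
  rw [card_reducedForms_eq_classNumber hK.1 hK.discr_neg]
  refine le_trans ?_ hheavy
  exact Nat.mul_le_mul_right _ (Nat.pow_le_pow_right two_pos (by omega))

/-! ## §B.2 The large-class-number part of the window -/

/-- **`#{d ∈ [−A·p², −1] : 2^{k}·p ≤ h(d)} ≤ A²·p²/2^{k}`** for `A, p ≥ 1`: the Gauss first moment (`…HeavyFirstMoment`,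
`#{h ≥ T}·T ≤ X·⌊√X⌋`) at `X = A·p²`, `T = 2^{k}·p`, with `⌊√(A p²)⌋ ≤ A·p`. [folklore] -/
theorem card_filter_le_classNumber_window_le {A p : ℕ} (hA : 1 ≤ A) (hp : 1 ≤ p) (k : ℕ) :
    ((((Icc (-((A * p ^ 2 : ℕ) : ℤ)) (-1)).filter
        (fun D ↦ 2 ^ k * p ≤ BinaryQuadraticForm.classNumber D)).card : ℕ) : ℝ) ≤
      (A : ℝ) ^ 2 * p ^ 2 / 2 ^ k := by
  have h := card_filter_le_classNumber_mul_le (A * p ^ 2) (2 ^ k * p)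
  have hsqrt : Nat.sqrt (A * p ^ 2) ≤ A * p := by
    calc Nat.sqrt (A * p ^ 2) ≤ Nat.sqrt ((A * p) ^ 2) := Nat.sqrt_le_sqrt (by nlinarith)
      _ = A * p := Nat.sqrt_eq' _
  have h' : ((Icc (-((A * p ^ 2 : ℕ) : ℤ)) (-1)).filter
      (fun D ↦ 2 ^ k * p ≤ BinaryQuadraticForm.classNumber D)).card * (2 ^ k * p) ≤ (A * p ^ 2) * (A * p) :=
    h.trans (Nat.mul_le_mul_left _ hsqrt)
  have h'' : ((((Icc (-((A * p ^ 2 : ℕ) : ℤ)) (-1)).filter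
      (fun D ↦ 2 ^ k * p ≤ BinaryQuadraticForm.classNumber D)).card : ℕ) : ℝ) * (2 ^ k * p) ≤
      (A * p ^ 2) * (A * p) := by exact_mod_cast h'
  have hp' : (0 : ℝ) < p := by exact_mod_cast hp
  rw [le_div_iff₀ (by positivity)]
  nlinarith

/-! ## §B.3 Fundamental discriminants with few prime factors are sparse -/

/-- **From the null density to a count**: for every `k` and `ε > 0` there is `X₀` with
`#{d square-free : |d| ≤ X, ω(|d|) ≤ k} ≤ ε·X` for all `X ≥ X₀` (the reference count of `twistDensity` is `≤ 2X + 1 ≤ 3X`).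
[cite: MontgomeryVaughan2007, §7.4] -/
theorem natCard_squarefree_card_primeFactors_le_eventually_le (k : ℕ) {ε : ℝ} (hε : 0 < ε) :
    ∃ X₀ : ℕ, ∀ X : ℕ, X₀ ≤ X →
      (Nat.card {d : ℤ | Squarefree d ∧ |d| ≤ (X : ℤ) ∧ d.natAbs.primeFactors.card ≤ k} : ℝ) ≤ ε * X := by
  have h := GoldfeldGoodTwists.twistDensity_zero_card_primeFactors_le k
  unfold twistDensity at h
  have h3 : (0 : ℝ) < ε / 3 := by positivity
  obtain ⟨X₀, hX₀⟩ := (Metric.tendsto_atTop.mp h) (ε / 3) h3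
  refine ⟨max X₀ 1, fun X hX ↦ ?_⟩
  have hX1 : 1 ≤ X := le_trans (le_max_right _ _) hX
  have hd := hX₀ X (le_trans (le_max_left _ _) hX)
  rw [Real.dist_eq, sub_zero] at hd
  have hpos : (0 : ℝ) < Nat.card {d : ℤ | Squarefree d ∧ |d| ≤ (X : ℤ)} := by
    exact_mod_cast natCard_squarefree_abs_le_pos hX1
  have hle := natCard_squarefree_abs_le_le X
  have hlt := (abs_lt.mp hd).2
  rw [div_lt_iff₀ hpos] at hlt
  have hX' : (1 : ℝ) ≤ X := by exact_mod_cast hX1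
  nlinarith [hlt, hle, Nat.cast_nonneg (α := ℝ) (Nat.card {d : ℤ | Squarefree d ∧ |d| ≤ (X : ℤ) ∧
    d.natAbs.primeFactors.card ≤ k})]

/-- **A field discriminant with `≤ k` prime factors is a square-free integer with `≤ k` prime factors, or `4` times one**
(`d_K` is fundamental: `isFundamentalDiscriminant_discr`; `ω(|d/4|) ≤ ω(|d|)`). The two square-free shadows, for
`d ∈ [−X, −1]`. [folklore] -/
theorem squarefree_or_four_dvd_of_discr_eq {K : Type*} [Field K] [NumberField K] (h2 : Module.finrank ℚ K = 2) {d : ℤ}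
    (hd : NumberField.discr K = d) :
    Squarefree d ∨ (4 ∣ d ∧ Squarefree (d / 4) ∧ (d / 4).natAbs.primeFactors.card ≤ d.natAbs.primeFactors.card) := by
  rcases isFundamentalDiscriminant_discr (K := K) h2 with ⟨-, hsq, -⟩ | ⟨h4, -, hsq⟩
  · exact Or.inl (hd ▸ hsq)
  · right
    subst hd
    refine ⟨h4, hsq, Finset.card_le_card ?_⟩
    have hmul : (NumberField.discr K).natAbs = 4 * (NumberField.discr K / 4).natAbs := by
      conv_lhs => rw [← Int.ediv_mul_cancel h4]
      rw [Int.natAbs_mul]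
      simp [mul_comm]
    rw [hmul]
    by_cases h0 : (NumberField.discr K / 4).natAbs = 0
    · simp [h0]
    · rw [Nat.primeFactors_mul (by norm_num) h0]
      exact Finset.subset_union_right

/-- ★ **Fundamental discriminants with few prime factors are sparse**: for every `k` and `ε > 0` there is `X₀` such that for
all `X ≥ X₀`, `#{d ∈ [−X, −1] : d = d_K for some imaginary quadratic K, ω(|d|) ≤ k} ≤ ε·X`. Proof: such `d` are square-free
with `ω ≤ k`, or `4s` with `s` square-free, `|s| ≤ X`, `ω(|s|) ≤ k` (injection `d ↦ d/4`), so the count is at most twice the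
square-free count of `natCard_squarefree_card_primeFactors_le_eventually_le`. [cite: MontgomeryVaughan2007, §7.4] -/
theorem card_filter_discr_card_primeFactors_le_eventually_le (k : ℕ) {ε : ℝ} (hε : 0 < ε) :
    ∃ X₀ : ℕ, ∀ X : ℕ, X₀ ≤ X →
      ((((Icc (-(X : ℤ)) (-1)).filter (fun d ↦
        (∃ (K : Type) (_ : Field K) (_ : NumberField K), IsImaginaryQuadratic K ∧ NumberField.discr K = d) ∧
          d.natAbs.primeFactors.card ≤ k)).card : ℕ) : ℝ) ≤ ε * X := by
  obtain ⟨X₀, hX₀⟩ := natCard_squarefree_card_primeFactors_le_eventually_le k (half_pos hε)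
  refine ⟨X₀, fun X hX ↦ ?_⟩
  set T : Set ℤ := {d : ℤ | Squarefree d ∧ |d| ≤ (X : ℤ) ∧ d.natAbs.primeFactors.card ≤ k} with hT
  have hTfin : T.Finite := finite_setOf_squarefree_abs_le X _
  have hTle : (Nat.card T : ℝ) ≤ ε / 2 * X := hX₀ X hX
  set S := (Icc (-(X : ℤ)) (-1)).filter (fun d ↦
        (∃ (K : Type) (_ : Field K) (_ : NumberField K), IsImaginaryQuadratic K ∧ NumberField.discr K = d) ∧
          d.natAbs.primeFactors.card ≤ k) with hS
  -- split S by square-freeness of d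
  set S₁ := S.filter (fun d ↦ Squarefree d) with hS₁
  set S₂ := S.filter (fun d ↦ ¬ Squarefree d) with hS₂
  have hsplit : S.card = S₁.card + S₂.card := by
    rw [hS₁, hS₂]; exact (card_filter_add_card_filter_not _).symm
  -- S₁ ⊆ T
  have h1 : S₁.card ≤ Nat.card T := by
    have hsub : (↑S₁ : Set ℤ) ⊆ T := by
      intro d hd
      rw [mem_coe, hS₁, mem_filter, hS, mem_filter, mem_Icc] at hd
      obtain ⟨⟨⟨hdX, hd1⟩, -, hk⟩, hsq⟩ := hd
      exact ⟨hsq, abs_le.mpr ⟨hdX, by omega⟩, hk⟩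
    have := Nat.card_mono hTfin hsub
    rwa [Nat.card_coe_set_eq, Set.ncard_coe_finset] at this
  -- S₂ ↪ T by d ↦ d / 4
  have h2 : S₂.card ≤ Nat.card T := by
    have hmem : ∀ d ∈ S₂, 4 ∣ d ∧ Squarefree (d / 4) ∧ (d / 4).natAbs.primeFactors.card ≤ k ∧
        -(X : ℤ) ≤ d ∧ d ≤ -1 := by
      intro d hd
      rw [hS₂, mem_filter, hS, mem_filter, mem_Icc] at hd
      obtain ⟨⟨⟨hdX, hd1⟩, ⟨K, _, _, hK, hdisc⟩, hk⟩, hnsq⟩ := hd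
      rcases squarefree_or_four_dvd_of_discr_eq hK.1 hdisc with hsq | ⟨h4, hsq4, hω⟩
      · exact absurd hsq hnsq
      · exact ⟨h4, hsq4, hω.trans hk, hdX, hd1⟩
    have hinj : Set.InjOn (fun d : ℤ ↦ d / 4) ↑S₂ := by
      intro d hd d' hd' (h : d / 4 = d' / 4)
      have h4 := (hmem d (mem_coe.mp hd)).1
      have h4' := (hmem d' (mem_coe.mp hd')).1
      rw [← Int.ediv_mul_cancel h4, ← Int.ediv_mul_cancel h4', h]
    rw [← card_image_of_injOn hinj]
    have hsub : (↑(S₂.image (fun d : ℤ ↦ d / 4)) : Set ℤ) ⊆ T := by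
      intro s hs
      rw [coe_image, Set.mem_image] at hs
      obtain ⟨d, hd, rfl⟩ := hs
      obtain ⟨h4, hsq4, hω, hdX, hd1⟩ := hmem d (mem_coe.mp hd)
      refine ⟨hsq4, abs_le.mpr ⟨?_, ?_⟩, hω⟩ <;> omega
    have := Nat.card_mono hTfin hsub
    rwa [Nat.card_coe_set_eq, Set.ncard_coe_finset] at this
  have hcard : (S.card : ℝ) ≤ 2 * Nat.card T := by
    rw [hsplit]; push_cast
    have h1' : (S₁.card : ℝ) ≤ Nat.card T := by exact_mod_cast h1
    have h2' : (S₂.card : ℝ) ≤ Nat.card T := by exact_mod_cast h2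
    linarith
  linarith

/-! ## §B.4 ★★ Heavy discriminants are sparse in the window `|d| ≤ A·p²` -/

/-- ★★ **HEAVY SPARSITY (the card's research lemma `HeavySparse`, absolute window form, PROVED).** For every `A ≥ 1` and
`η > 0` there is `p₀` such that for every `p ≥ p₀` the number of `d ∈ [−A·p², −1]` which are the discriminant of an imaginary
quadratic field `K` with `2^{ω(|d|)−1}·p ≤ h_K` (HEAVY for `p`) is at most `η·A·p²`. Proof: with `2^{k} ≥ 2A/η`, a heavy `d`
has `ω(|d|) ≤ k` (at most `(η/2)·A p²` of them for `p ≥ p₀`, §B.3) or `h(d) ≥ 2^{k}p` (at most `A²p²/2^{k} ≤ (η/2)·A p²` of them,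
§B.2). W-free, L-free; `p` need not be prime. [cite: Cox2013, §3.B Thm. 3.15] -/
theorem heavySparse_window (A : ℕ) (η : ℝ) (hA : 1 ≤ A) (hη : 0 < η) :
    ∃ p₀ : ℕ, ∀ p : ℕ, p₀ ≤ p →
      ((((Icc (-((A * p ^ 2 : ℕ) : ℤ)) (-1)).filter (fun d ↦
        ∃ (K : Type) (_ : Field K) (_ : NumberField K), IsImaginaryQuadratic K ∧ NumberField.discr K = d ∧
          2 ^ (d.natAbs.primeFactors.card - 1) * p ≤ NumberField.classNumber K)).card : ℕ) : ℝ) ≤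
        η * ((A * p ^ 2 : ℕ) : ℝ) := by
  -- choose k with 2^k ≥ 2A/η
  obtain ⟨k, hk⟩ : ∃ k : ℕ, 2 * (A : ℝ) / η ≤ 2 ^ k := by
    obtain ⟨k, hk⟩ := pow_unbounded_of_one_lt (2 * (A : ℝ) / η) (by norm_num : (1 : ℝ) < 2)
    exact ⟨k, hk.le⟩
  obtain ⟨X₀, hX₀⟩ := card_filter_discr_card_primeFactors_le_eventually_le k (half_pos hη)
  refine ⟨max X₀ 1, fun p hp ↦ ?_⟩
  have hp1 : 1 ≤ p := le_trans (le_max_right _ _) hp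
  have hpX : X₀ ≤ A * p ^ 2 := by
    calc X₀ ≤ p := le_trans (le_max_left _ _) hp
      _ ≤ A * p ^ 2 := by nlinarith
  set X : ℕ := A * p ^ 2 with hXdef
  set H := (Icc (-(X : ℤ)) (-1)).filter (fun d ↦
        ∃ (K : Type) (_ : Field K) (_ : NumberField K), IsImaginaryQuadratic K ∧ NumberField.discr K = d ∧
          2 ^ (d.natAbs.primeFactors.card - 1) * p ≤ NumberField.classNumber K) with hH
  set S := (Icc (-(X : ℤ)) (-1)).filter (fun d ↦
        (∃ (K : Type) (_ : Field K) (_ : NumberField K), IsImaginaryQuadratic K ∧ NumberField.discr K = d) ∧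
          d.natAbs.primeFactors.card ≤ k) with hS
  set L := (Icc (-(X : ℤ)) (-1)).filter (fun D ↦ 2 ^ k * p ≤ BinaryQuadraticForm.classNumber D) with hL
  have hsub : H ⊆ S ∪ L := by
    intro d hd
    rw [hH, mem_filter] at hd
    obtain ⟨hdI, K, iF, iN, hK, hdisc, hheavy⟩ := hd
    rw [mem_union, hS, hL, mem_filter, mem_filter]
    by_cases hω : d.natAbs.primeFactors.card ≤ k
    · exact Or.inl ⟨hdI, ⟨K, iF, iN, hK, hdisc⟩, hω⟩
    · right
      refine ⟨hdI, ?_⟩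
      subst hdisc
      exact two_pow_mul_le_classNumber_of_heavy hK hheavy (by omega)
  have hS' : (S.card : ℝ) ≤ η / 2 * X := hX₀ X hpX
  have hL' : (L.card : ℝ) ≤ (A : ℝ) ^ 2 * p ^ 2 / 2 ^ k := card_filter_le_classNumber_window_le hA hp1 k
  have hL'' : (A : ℝ) ^ 2 * p ^ 2 / 2 ^ k ≤ η / 2 * X := by
    rw [hXdef]; push_cast
    have h2k : (0 : ℝ) < 2 ^ k := by positivity
    rw [div_le_iff₀ h2k]
    rw [div_le_iff₀ hη] at hk
    have hA' : (0 : ℝ) ≤ A := by positivity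
    have hp' : (0 : ℝ) ≤ (p : ℝ) ^ 2 := by positivity
    nlinarith [mul_nonneg hA' hp']
  have hHcard : (H.card : ℝ) ≤ S.card + L.card := by
    exact_mod_cast (card_le_card hsub).trans (card_union_le _ _)
  calc (H.card : ℝ) ≤ S.card + L.card := hHcard
    _ ≤ η / 2 * X + η / 2 * X := by linarith
    _ = η * X := by ring

end Summit.BirchSwinnertonDyer.BirchSwinnertonDyer.Theorems.HeavyDiscriminant

end
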